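import Literature.MathematicalPhysics.QuantumManyBody.BoseEinsteinCondensation
import Summits.AtomisticToContinuum.BoseEinsteinCondensation.Theorems.BECHardSphereReductionHardCoreDominatesDiniReduction
import HarnessLib

/-!
# `BoundaryTransferWeak` (stmt-AtomisticToContinuum-0827), line `mode_free_reward` — condensed near-minimisers
# from the mode-free chord bound (stub `stub_condensedMinimisersOfChord` of piece X₂ `ModeFreeSlopeToBEC`)

Supports stmt-AtomisticToContinuum-0827 (crux `BoundaryTransferWeak`, the boundary-condition transfer
"torus BEC ⇒ Dirichlet ground-state BEC"; split D11, line `mode_free_reward`, piece X₂). The line works with the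
MODE-FREE rewarded infimum

  `G_N(λ) = inf_Ψ [⟨Ψ, H_N Ψ⟩ + λ (N − λ_max(γ_Ψ))]`  (`λ_max = maxOccupation`, `Ψ` a Dirichlet trial state).

This file is the fixed-`(N, L)` VARIATIONAL EXTRACTION step, pure `ℝ≥0∞` bookkeeping with no physics:
if `E₀ < ∞` and `G_N(λ) ≤ E₀ + λ (1 − c) N` for all `0 < λ ≤ λ₁` (`0 < c ≤ 1`), then for every slack `η > 0`
and every `ε > 0` some trial state is `η`-close to `E₀` in energy and has `λ_max ≥ (c − ε) N`
(`stub_condensedMinimisersOfChord`, the registered signature of the lead's skeleton).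

Proof: if `(c − ε) N ≤ 0` any `η`-near-minimiser does. Otherwise `N ≥ 1`, `ε < c ≤ 1`; put `η' = min η 1`,
`t = η'.toReal > 0`, `λ = min λ₁ (t / 4N)`, and take a near-minimiser `Ψ` of the `λ`-rewarded functional at the
(strictly larger, finite) level `E₀ + λ(1 − c)N + λεN/2`. Since `E₀ ≤ ⟨Ψ, HΨ⟩` and `λ_max(γ_Ψ) ≤ N`
(`maxOccupation_le_card`) every term is finite, and in `ℝ`: the energy exceeds `E₀` by `< 2λN ≤ t/2`, and
`λ (N − λ_max) < λ(1 − c)N + λεN/2` gives `λ_max > (c − ε/2) N ≥ (c − ε) N`.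
-/

noncomputable section

open MeasureTheory Filter
open scoped ENNReal NNReal

namespace Summit.AtomisticToContinuum.BoseEinsteinCondensation.ModeFreeReward

open Literature.MathematicalPhysics.QuantumManyBody.BoseGas
open Summit.AtomisticToContinuum.BoseEinsteinCondensation.Cruxes.HardCoreDominates.Birth (maxOccupation_le_card)

/-- Every positive slack level above a finite ground-state energy contains a trial state
(`E₀ < E₀ + η` and the definition of the infimum). [folklore] -/
theorem exists_energy_le_groundStateEnergy_add {v : ℝ → ℝ≥0∞} {N : ℕ} {L : ℝ}
    (hE : groundStateEnergy v N L ≠ ⊤) {η : ℝ≥0∞} (hη : 0 < η) :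
    ∃ Ψ : TrialState N L, energy v Ψ ≤ groundStateEnergy v N L + η := by
  obtain ⟨Ψ, hΨ⟩ := iInf_lt_iff.1 (ENNReal.lt_add_right hE hη.ne')
  exact ⟨Ψ, hΨ.le⟩

/-- **Condensed near-minimisers from the mode-free chord bound** (fixed `N`, `L`; registered stub
`stub_condensedMinimisersOfChord` of line `mode_free_reward`): if `E₀ < ∞` and the mode-free rewarded infimum
obeys `G_N(λ) ≤ E₀ + λ (1 − c) N` for all `0 < λ ≤ λ₁` (`0 < c ≤ 1`), then for every slack `η > 0` and every
`ε > 0` some Dirichlet trial state lies within `η` of `E₀` and has `λ_max(γ_Ψ) ≥ (c − ε) N` (a near-minimiser of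
the `λ`-rewarded functional with `λ = min λ₁ (η'/4N)`, `η' = min η 1`). [folklore] -/
theorem stub_condensedMinimisersOfChord :
    ∀ (v : ℝ → ℝ≥0∞) (N : ℕ) (L : ℝ) (c lam₁ : ℝ), 0 < lam₁ → 0 < c → c ≤ 1 →
      groundStateEnergy v N L ≠ ⊤ →
      (∀ lam : ℝ, 0 < lam → lam ≤ lam₁ →
        (⨅ Ψ : TrialState N L, energy v Ψ + ENNReal.ofReal lam * ((N : ℝ≥0∞) - maxOccupation N Ψ.ψ)) ≤
          groundStateEnergy v N L + ENNReal.ofReal (lam * (1 - c) * N)) →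
      ∀ η : ℝ≥0∞, 0 < η → ∀ ε : ℝ, 0 < ε → ∃ Ψ : TrialState N L,
        energy v Ψ ≤ groundStateEnergy v N L + η ∧
          ENNReal.ofReal ((c - ε) * N) ≤ maxOccupation N Ψ.ψ := by
  intro v N L c lam₁ hlam₁ hc hc1 hE hG η hη ε hε
  -- trivial branch: `(c - ε) N ≤ 0`, any `η`-near-minimiser does
  rcases le_or_gt ((c - ε) * N) 0 with htriv | hpos
  · obtain ⟨Ψ, hΨ⟩ := exists_energy_le_groundStateEnergy_add hE hη
    exact ⟨Ψ, hΨ, by rw [ENNReal.ofReal_of_nonpos htriv]; exact bot_le⟩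
  -- interesting branch: `ε < c` and `N ≥ 1`
  have hεc : ε < c := by
    by_contra h
    have h1 : (c - ε) * N ≤ 0 := mul_nonpos_iff.2 (Or.inr ⟨sub_nonpos.2 (not_lt.1 h), N.cast_nonneg⟩)
    exact (not_lt.2 h1) hpos
  have hN : (0 : ℝ) < N := by
    rcases (N.cast_nonneg : (0 : ℝ) ≤ N).eq_or_lt with h | h
    · rw [← h, mul_zero] at hpos
      exact absurd hpos (lt_irrefl 0)
    · exact h
  -- the slack `η' = min η 1` as a positive real number `t`
  set η' : ℝ≥0∞ := min η 1 with hη'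
  have hη'top : η' ≠ ⊤ := ne_top_of_le_ne_top ENNReal.one_ne_top (min_le_right _ _)
  have hη'pos : 0 < η' := lt_min hη one_pos
  set t : ℝ := η'.toReal with ht
  have htpos : 0 < t := ENNReal.toReal_pos hη'pos.ne' hη'top
  -- the reward `lam = min lam₁ (t / 4N)`
  set lam : ℝ := min lam₁ (t / (4 * N)) with hlamdef
  have hlampos : 0 < lam := lt_min hlam₁ (div_pos htpos (by linarith))
  have hlamle : lam ≤ lam₁ := min_le_left _ _
  have hlamN : lam * N ≤ t / 4 :=
    calc lam * N ≤ t / (4 * N) * N := mul_le_mul_of_nonneg_right (min_le_right _ _) N.cast_nonneg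
      _ = t / 4 := by rw [div_mul_eq_mul_div, mul_div_mul_right _ _ hN.ne']
  -- a near-minimiser of the `lam`-rewarded functional at the level `E₀ + lam (1 - c) N + lam ε N / 2`
  have hGlam := hG lam hlampos hlamle
  set E₀ := groundStateEnergy v N L with hE₀
  set a : ℝ := lam * (1 - c) * N with ha
  set b : ℝ := lam * ε * N / 2 with hb
  have ha0 : 0 ≤ a := mul_nonneg (mul_nonneg hlampos.le (sub_nonneg.2 hc1)) N.cast_nonneg
  have hb0 : 0 < b := div_pos (mul_pos (mul_pos hlampos hε) hN) two_pos
  have hfin : E₀ + ENNReal.ofReal a ≠ ⊤ := ENNReal.add_ne_top.2 ⟨hE, ENNReal.ofReal_ne_top⟩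
  have hRtop : E₀ + ENNReal.ofReal a + ENNReal.ofReal b ≠ ⊤ :=
    ENNReal.add_ne_top.2 ⟨hfin, ENNReal.ofReal_ne_top⟩
  have hlt : (⨅ Ψ : TrialState N L,
      energy v Ψ + ENNReal.ofReal lam * ((N : ℝ≥0∞) - maxOccupation N Ψ.ψ)) <
        E₀ + ENNReal.ofReal a + ENNReal.ofReal b :=
    hGlam.trans_lt (ENNReal.lt_add_right hfin (ENNReal.ofReal_pos.2 hb0).ne')
  obtain ⟨Ψ, hΨ⟩ := iInf_lt_iff.1 hlt
  -- finiteness bookkeeping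
  have hm : maxOccupation N Ψ.ψ ≤ N := maxOccupation_le_card Ψ
  have hmtop : maxOccupation N Ψ.ψ ≠ ⊤ := ne_top_of_le_ne_top (ENNReal.natCast_ne_top N) hm
  have hsubtop : (N : ℝ≥0∞) - maxOccupation N Ψ.ψ ≠ ⊤ := ENNReal.sub_ne_top (ENNReal.natCast_ne_top N)
  have hLtop : energy v Ψ + ENNReal.ofReal lam * ((N : ℝ≥0∞) - maxOccupation N Ψ.ψ) ≠ ⊤ := hΨ.ne_top
  have hetop : energy v Ψ ≠ ⊤ := (ENNReal.add_ne_top.1 hLtop).1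
  have hmN : (maxOccupation N Ψ.ψ).toReal ≤ N := by
    have h := ENNReal.toReal_mono (ENNReal.natCast_ne_top N) hm
    rwa [ENNReal.toReal_natCast] at h
  have hE₀e : E₀.toReal ≤ (energy v Ψ).toReal :=
    ENNReal.toReal_mono hetop (groundStateEnergy_le_energy v Ψ)
  -- to real numbers
  have hreal : (energy v Ψ).toReal + lam * ((N : ℝ) - (maxOccupation N Ψ.ψ).toReal) <
      E₀.toReal + a + b := by
    have h := (ENNReal.toReal_lt_toReal hLtop hRtop).2 hΨ
    rwa [ENNReal.toReal_add hetop (ENNReal.mul_ne_top ENNReal.ofReal_ne_top hsubtop),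
      ENNReal.toReal_mul, ENNReal.toReal_ofReal hlampos.le,
      ENNReal.toReal_sub_of_le hm (ENNReal.natCast_ne_top N), ENNReal.toReal_natCast,
      ENNReal.toReal_add hfin ENNReal.ofReal_ne_top, ENNReal.toReal_add hE ENNReal.ofReal_ne_top,
      ENNReal.toReal_ofReal ha0, ENNReal.toReal_ofReal hb0.le] at h
  have hlamN0 : 0 ≤ lam * N := mul_nonneg hlampos.le N.cast_nonneg
  have ha_le : a ≤ lam * N := by
    have e : a = lam * N * (1 - c) := by rw [ha]; ring
    rw [e]
    exact (mul_le_mul_of_nonneg_left (by linarith) hlamN0).trans_eq (mul_one _)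
  have hb_le : b ≤ lam * N := by
    have e : b = lam * N * (ε / 2) := by rw [hb]; ring
    rw [e]
    exact (mul_le_mul_of_nonneg_left (by linarith) hlamN0).trans_eq (mul_one _)
  have hx0 : 0 ≤ lam * ((N : ℝ) - (maxOccupation N Ψ.ψ).toReal) :=
    mul_nonneg hlampos.le (sub_nonneg.2 hmN)
  refine ⟨Ψ, ?_, ?_⟩
  · -- the energy is within `η' ≤ η` of `E₀`
    have h1 : (energy v Ψ).toReal ≤ E₀.toReal + t := by linarith
    have h2 : energy v Ψ ≤ E₀ + η' := by
      refine (ENNReal.toReal_le_toReal hetop (ENNReal.add_ne_top.2 ⟨hE, hη'top⟩)).1 ?_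
      rw [ENNReal.toReal_add hE hη'top]
      exact h1
    exact h2.trans (add_le_add le_rfl (min_le_left _ _))
  · -- the occupation is `≥ (c - ε) N`
    have h3 : (c - ε) * N ≤ (maxOccupation N Ψ.ψ).toReal := by
      by_contra hcon
      have hlt' : (1 - c) * N + ε * N / 2 < (N : ℝ) - (maxOccupation N Ψ.ψ).toReal := by
        have h0 : 0 ≤ ε * N := mul_nonneg hε.le N.cast_nonneg
        have h4 := not_le.1 hcon
        nlinarith [h4, h0]
      have h5 := mul_lt_mul_of_pos_left hlt' hlampos
      have hab : lam * ((1 - c) * N + ε * N / 2) = a + b := by rw [ha, hb]; ring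
      nlinarith [hreal, hE₀e, h5, hab]
    calc ENNReal.ofReal ((c - ε) * N) ≤ ENNReal.ofReal ((maxOccupation N Ψ.ψ).toReal) :=
          ENNReal.ofReal_le_ofReal h3
      _ = maxOccupation N Ψ.ψ := ENNReal.ofReal_toReal hmtop

end Summit.AtomisticToContinuum.BoseEinsteinCondensation.ModeFreeReward

end
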